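import Literature.InformationTheory.QuantumCodes.LDPCCountingThreshold
import Literature.InformationTheory.QuantumCodes.CodeCapacityNoise
import Mathlib.Analysis.SpecialFunctions.Sqrt
import HarnessLib

/-!
# A certified error-correction threshold for every LDPC family under minimum-weight decoding
# (the Kovalev–Pryadko / Gottesman counting bound, packaged as a threshold; LADDER-QEC Q5)

Venture QEC, `Summits/Ventures/QEC/Thresholds/` (PARTITION row 09 "HasThreshold"; qec-lit-2 INBOX
2026-08-26T17:21:04Z "what remains on YOUR side is only vocabulary glue … (iv) HasThreshold").
HONEST FRAMING: this file is UNCONDITIONAL and kernel-tier — no named fact, no `native_decide`; it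
is the ASSEMBLY of three accepted Literature theorems (`ClusterCountingBound.lean` p457291,
`MinWeightDecodingClusters.lean` p457992, `LDPCCountingThreshold.lean` p458451: the finite-length
bound `sum_decodingFails_bernoulli_le`) with the threshold vocabulary of `CodeCapacityNoise.lean`
(`IsThresholdLowerBound`, `BelowThreshold.of_le`). The printed theorems (Kovalev–Pryadko 2013
Thm. 3; Gottesman 2014 Thm. 3: "`p < p₀ = (2ze)⁻²`, `z = (r-1)c`") have the lattice-animal constant
`ze`; the tree's entropy bound gives `Δ²` instead, hence the WEAKER but CERTIFIED value
`p₀ = (2Δ²)⁻² = 1/(4Δ⁴)` for a check graph of maximal degree `Δ` (for the toric code, `Δ = 6`: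
`p₀ = 1/5184 ≈ 1.9 × 10⁻⁴` — far below the DKLP walk-count values of `ToricCodeThresholds.lean`, but
by a different, fully proved route and for EVERY bounded-degree family). No Monte Carlo number here.

**Statement** (`ldpc_isThresholdLowerBound`). Data, indexed by `i : ℕ`: one error type of a CSS
(or classical, `SX = ⊥`) code — a check matrix `H i : Matrix (Fin (m i)) (Fin (n i)) (ZMod 2)`, the
subspace `SX i` of trivial errors, ANY minimum-weight decoder `D i` (`IsMinWeightDecoder`), a number
`d i ≥ 1` below the relevant distance (`d i ≤ ‖x‖` for all `x ∈ ker (H i) ∖ SX i`); hypotheses: the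
check graphs have degree `≤ Δ` (`Δ ≥ 1`; for row weight `≤ w` and column weight `≤ c` take
`Δ = c(w-1)`, `degree_checkGraph_le`), and the family is SUBEXPONENTIAL IN ITS DISTANCE:
`n i · r^{d i} → 0` for every `0 < r < 1` (true whenever `d i → ∞` and `log n i = o(d i)`, e.g.
`d ≥ n^α`, or the toric code `n = 2L²`, `d = L`). Conclusion: `1/(4Δ⁴)` is a threshold lower bound
(`IsThresholdLowerBound`) for the failure probabilities
`cssFailureFamily H SX D i p = Σ_{E : decoding of E fails} p^{|E|}(1-p)^{n_i-|E|}` under independent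
errors of rate `p` — i.e. for every `0 ≤ p < 1/(4Δ⁴)` the failure probability tends to `0`.

## References

* [KovalevPryadko2013] A. A. Kovalev, L. P. Pryadko, Phys. Rev. A 87 (2013) 020304(R),
  arXiv:1208.2317, Thm. 3.
* [Gottesman2014] D. Gottesman, Quantum Inf. Comput. 14 (2014) 1338, arXiv:1310.2984, §4 Thm. 3.
* [DennisEtAl2002] Dennis–Kitaev–Landahl–Preskill, J. Math. Phys. 43 (2002) 4452, §4.3 (threshold
  definition).
-/

noncomputable section

namespace Summit.Ventures.QEC.Thresholds

open Filter Topology Finset Matrix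
open Literature.InformationTheory.QuantumCodes
open Literature.Probability.LatticeModels

variable {n m : ℕ → ℕ}

open Classical in
/-- The failure-probability family of ONE ERROR TYPE of a family of CSS codes under independent
errors of rate `p` and decoders `D i`: `(i, p) ↦ Σ_{E ⊆ Fin (n i) : DecodingFails (H i) (SX i) (D i) E}
p^{|E|} (1-p)^{n i - |E|}` (the left-hand side of the tree's `sum_decodingFails_bernoulli_le`, as a
function of the family index and the rate). [cite: Gottesman2014, Thm 3 (logical error rate of the family)] -/
def cssFailureFamily (H : ∀ i, Matrix (Fin (m i)) (Fin (n i)) (ZMod 2))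
    (SX : ∀ i, Submodule (ZMod 2) (Fin (n i) → ZMod 2))
    (D : ∀ i, (Fin (m i) → ZMod 2) → (Fin (n i) → ZMod 2)) : ℕ → ℝ → ℝ :=
  fun i p => ∑ E ∈ univ.filter (fun E => DecodingFails (H i) (SX i) (D i) E), bernoulliWeight p E

/-- The failure probabilities are non-negative for `0 ≤ p ≤ 1`. [cite: Gottesman2014, Thm 3] -/
theorem cssFailureFamily_nonneg (H : ∀ i, Matrix (Fin (m i)) (Fin (n i)) (ZMod 2))
    (SX : ∀ i, Submodule (ZMod 2) (Fin (n i) → ZMod 2))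
    (D : ∀ i, (Fin (m i) → ZMod 2) → (Fin (n i) → ZMod 2)) (i : ℕ) {p : ℝ} (hp₀ : 0 ≤ p)
    (hp₁ : p ≤ 1) : 0 ≤ cssFailureFamily H SX D i p :=
  Finset.sum_nonneg fun E _ => bernoulliWeight_nonneg hp₀ hp₁ E

/-- `p < 1/(4Δ⁴)` is exactly the printed smallness condition `r = 2Δ²√p < 1` (for `p ≥ 0`, `Δ ≥ 1`).
[cite: Gottesman2014, Thm 3 (p < p₀ = (2z e)^{-2})] -/
theorem two_mul_sq_mul_sqrt_lt_one {Δ : ℕ} (hΔ1 : 1 ≤ Δ) {p : ℝ}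
    (hp : p < 1 / (4 * (Δ : ℝ) ^ 4)) : 2 * (Δ : ℝ) ^ 2 * Real.sqrt p < 1 := by
  have hΔ : (1 : ℝ) ≤ Δ := by exact_mod_cast hΔ1
  have hΔ2 : 0 < 2 * (Δ : ℝ) ^ 2 := by positivity
  have hsq : Real.sqrt p < 1 / (2 * (Δ : ℝ) ^ 2) := by
    rw [Real.sqrt_lt' (by positivity)]
    calc p < 1 / (4 * (Δ : ℝ) ^ 4) := hp
      _ = (1 / (2 * (Δ : ℝ) ^ 2)) ^ 2 := by field_simp; ring
  calc 2 * (Δ : ℝ) ^ 2 * Real.sqrt p < 2 * (Δ : ℝ) ^ 2 * (1 / (2 * (Δ : ℝ) ^ 2)) := by gcongr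
    _ = 1 := by field_simp

/-- **Certified threshold for bounded-degree (LDPC) families under minimum-weight decoding**
(Kovalev–Pryadko 2013 Thm. 3 / Gottesman 2014 Thm. 3 with the tree's animal constant): for one
error type of any family of CSS codes with check graphs of degree `≤ Δ` (`Δ ≥ 1`), numbers
`1 ≤ d i ≤` the relevant distance, ANY minimum-weight decoders, and subexponential size
`n i · r^{d i} → 0` for all `0 < r < 1`, the value `1/(4Δ⁴) = (2Δ²)⁻²` is a lower bound on the
accuracy threshold under independent errors: every `0 ≤ p < 1/(4Δ⁴)` has failure probability `→ 0`.
UNCONDITIONAL, kernel-tier (assembles `sum_decodingFails_bernoulli_le`). Printed: "`p < p₀ = (2ze)⁻²`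
… the logical error rate … approaches `0` as `i → ∞`". [cite: Gottesman2014, Thm 3] -/
theorem ldpc_isThresholdLowerBound (H : ∀ i, Matrix (Fin (m i)) (Fin (n i)) (ZMod 2))
    (SX : ∀ i, Submodule (ZMod 2) (Fin (n i) → ZMod 2))
    (D : ∀ i, (Fin (m i) → ZMod 2) → (Fin (n i) → ZMod 2)) (hD : ∀ i, IsMinWeightDecoder (H i) (D i))
    (d : ℕ → ℕ) (hd1 : ∀ i, 1 ≤ d i)
    (hd : ∀ i (x : Fin (n i) → ZMod 2), H i *ᵥ x = 0 → x ∉ SX i → d i ≤ hammingNorm x)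
    {Δ : ℕ} (hΔ1 : 1 ≤ Δ)
    (hΔ : ∀ i, ∀ [DecidableRel (checkGraph (H i)).Adj], ∀ v, (checkGraph (H i)).degree v ≤ Δ)
    (hgrowth : ∀ r : ℝ, 0 < r → r < 1 → Tendsto (fun i => (n i : ℝ) * r ^ d i) atTop (𝓝 0)) :
    IsThresholdLowerBound (cssFailureFamily H SX D) (1 / (4 * (Δ : ℝ) ^ 4)) := by
  classical
  intro p hp₀ hpp
  have hΔr : (1 : ℝ) ≤ Δ := by exact_mod_cast hΔ1
  have hp₁ : p ≤ 1 := by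
    have : 1 / (4 * (Δ : ℝ) ^ 4) ≤ 1 := by
      rw [div_le_one (by positivity)]
      nlinarith [pow_le_pow_left₀ zero_le_one hΔr 4]
    linarith
  set r : ℝ := 2 * (Δ : ℝ) ^ 2 * Real.sqrt p with hr
  have hr1 : r < 1 := two_mul_sq_mul_sqrt_lt_one hΔ1 hpp
  have hr0 : 0 ≤ r := by positivity
  -- the finite-length bound, at every index
  have hbound : ∀ i, cssFailureFamily H SX D i p ≤
      (n i : ℝ) * r ^ d i / ((Δ : ℝ) ^ 2 * (1 - r)) := fun i =>
    sum_decodingFails_bernoulli_le (H i) (SX i) (hD i) (hd1 i) (hd i) hΔ1 (hΔ i) hp₀ hp₁ hr1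
  -- the right-hand side tends to `0`
  have hQ : Tendsto (fun i => (n i : ℝ) * r ^ d i / ((Δ : ℝ) ^ 2 * (1 - r))) atTop (𝓝 0) := by
    rcases hr0.eq_or_lt with hr00 | hrpos
    · have : (fun i => (n i : ℝ) * r ^ d i / ((Δ : ℝ) ^ 2 * (1 - r))) = fun _ => 0 := by
        funext i
        rw [← hr00, zero_pow (by have := hd1 i; omega)]
        simp
      rw [this]
      exact tendsto_const_nhds
    · have h := (hgrowth r hrpos hr1).div_const ((Δ : ℝ) ^ 2 * (1 - r))
      simpa using h
  have hQ' : BelowThreshold (fun i (_ : ℝ) => (n i : ℝ) * r ^ d i / ((Δ : ℝ) ^ 2 * (1 - r))) p := hQ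
  exact BelowThreshold.of_le (P := cssFailureFamily H SX D) hQ'
    (fun i => cssFailureFamily_nonneg H SX D i hp₀ hp₁) hbound

end Summit.Ventures.QEC.Thresholds

end
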